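import Literature.NumberTheory.EllipticCurves.FormalGroupLaurentPointsAllCharProofs
import Literature.NumberTheory.EllipticCurves.FormalGroupFiniteHeightProofs
import HarnessLib

/-!
# Honda's congruences for `log_E` and the finite height `[p]˜ ≠ 0` at EVERY good prime,
# `p = 2` included (proofs only)

Topic `NumberTheory/EllipticCurves` (theorems only; no definition, no named fact). The files
`FormalGroupFrobeniusTypeProofs` (Honda 1970, Thm. 9: `log_W` is of Honda type `p − aT + T²`,
`a = p + 1 − #Ṽ(𝔽_p)`) and `FormalGroupFiniteHeightProofs` (`[p]˜ ≠ 0`) assume `p` odd, solely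
because the dictionary `laurentPt_formalGroupLaw / laurentPt_formalMul` ("the formal group law
computes `E(𝔽_p⸨X⸩)`") was proved for `char ≠ 2`. With the characteristic-free dictionary of
`FormalGroupLaurentPointsAllCharProofs` (`laurentPt_formalGroupLaw'`, `laurentPt_formalMul'`) the
same proofs give, for every prime `p` and every Weierstrass equation `V/ℤ_p` with elliptic generic
and special fibres:

* `frobenius_formal_identity_of_nonneg' / _of_neg'`: `F̃(X^{p²}, [p]˜X) = [a]˜(Xᵖ)` resp.
  `ĩ([|a|]˜(Xᵖ))` in `𝔽_p⟦X⟧` (Manin's `π² − aπ + p = 0`, `HasseManin.frob_relation`, which already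
  covers characteristic `2`, read on the formal point);
* `norm_coeff_hondaShift_formalLog_le_one'`: `hondaShift p a log_W ∈ ℤ_p⟦X⟧` (the Atkin–
  Swinnerton-Dyer / Honda congruences), all `p`;
* `formalMul_prime_map_toZMod_ne_zero'`, `formalMul_map_toZMod_ne_zero'`,
  `exists_isUnit_coeff_formalMul_subst'`, `exists_isUnit_coeff_formalMul'`: finite height, all `p`.

These are inputs (i) (finite height) and, through `HondaStrongIsomorphismAllPrimesProofs`, (ii)
(Honda's strong isomorphism) at a GOOD prime `p = 2` of the finite-height route to the integrality
of the Manin constant (`NeronIsogenyScaling.lean`, "A finite-height refinement"; fact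
`edixhoven_int_of_neronLattice_eq_smul_periodLattice`).

## References

* T. Honda, *On the theory of commutative formal groups*, J. Math. Soc. Japan 22 (1970), 213–246,
  §6.2, Thm. 9; §2, Thm. 2 (p. 223). [Honda1970]
* M. Hazewinkel, *Formal Groups and Applications* (1978), §33.1.
* J. H. Silverman, *The Arithmetic of Elliptic Curves*, 2nd ed. (2009), Thm. V.2.3.1(b), IV.5,
  IV.7. [cite: SilvermanAEC2009]
-/

noncomputable section

open scoped Classical

namespace WeierstrassCurve

open scoped LaurentSeries
open PowerSeries Literature.NumberTheory.EllipticCurves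

/-! ## The Frobenius identity in the reduced formal group, every `p` -/

section FormalIdentity

variable {p : ℕ} [hp : Fact p.Prime] (V : WeierstrassCurve ℤ_[p]) [hE : (V.map PadicInt.Coe.ringHom).IsElliptic]
  [hEt : (V.map PadicInt.toZMod).IsElliptic]

/-- **The Frobenius identity in the formal group of `Ẽ = V ⊗ 𝔽_p`, case `a ≥ 0`, every prime `p`**:
`F̃(X^{p²}, [p]˜(X)) = [a]˜(Xᵖ)` in `𝔽_p⟦X⟧`, `a = p + 1 − #Ẽ(𝔽_p)` — as
`frobenius_formal_identity_of_nonneg`, with the characteristic-free dictionary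
`laurentPt_formalGroupLaw'` / `laurentPt_formalMul'`. [Honda 1970, §6.2, proof of Thm. 9]
[cite: SilvermanAEC2009, Thm. V.2.3.1(b)] -/
theorem frobenius_formal_identity_of_nonneg'
    (ha : 0 ≤ Literature.NumberTheory.EllipticCurves.HasseManin.tr (V.map PadicInt.toZMod)) :
    MvPowerSeries.subst ![(PowerSeries.X : (ZMod p)⟦X⟧) ^ p ^ 2,
        ((V.map PadicInt.toZMod).formalMul p).subst (PowerSeries.X : (ZMod p)⟦X⟧)] (V.map PadicInt.toZMod).formalGroupLaw =
      ((V.map PadicInt.toZMod).formalMul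
        (Literature.NumberTheory.EllipticCurves.HasseManin.tr (V.map PadicInt.toZMod)).toNat).subst
        ((PowerSeries.X : (ZMod p)⟦X⟧) ^ p) := by
  set a := Literature.NumberTheory.EllipticCurves.HasseManin.tr (V.map PadicInt.toZMod) with hadef
  have hp0 : p ≠ 0 := hp.out.ne_zero
  have hX : constantCoeff (PowerSeries.X : (ZMod p)⟦X⟧) = 0 := PowerSeries.constantCoeff_X
  have hXp : constantCoeff ((PowerSeries.X : (ZMod p)⟦X⟧) ^ p) = 0 := constantCoeff_pow_prime hX hp0
  have hXp2 : constantCoeff ((PowerSeries.X : (ZMod p)⟦X⟧) ^ p ^ 2) = 0 :=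
    constantCoeff_pow_prime hX (pow_ne_zero 2 hp0)
  have hpX : constantCoeff (((V.map PadicInt.toZMod).formalMul p).subst (PowerSeries.X : (ZMod p)⟦X⟧)) = 0 :=
    (Literature.RingTheory.FormalGroups.constantCoeff_subst_of_constantCoeff_eq_zero hX _).trans
      ((V.map PadicInt.toZMod).constantCoeff_formalMul p)
  have hrel := (V.map PadicInt.toZMod).frob_relation_laurentPt
  rw [← hadef] at hrel
  refine laurentPt_injective (E := V.map PadicInt.toZMod)
    (constantCoeff_formalGroupLaw_subst_pair V PadicInt.toZMod hXp2 hpX)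
    ((Literature.RingTheory.FormalGroups.constantCoeff_subst_of_constantCoeff_eq_zero hXp _).trans
      ((V.map PadicInt.toZMod).constantCoeff_formalMul _)) ?_
  rw [laurentPt_formalGroupLaw' V PadicInt.toZMod hXp2 hpX, laurentPt_formalMul' V PadicInt.toZMod p hX,
    laurentPt_formalMul' V PadicInt.toZMod _ hXp, ← natCast_zsmul, ← natCast_zsmul, Int.toNat_of_nonneg ha]
  rw [sub_add_eq_add_sub, sub_eq_zero] at hrel
  exact hrel

/-- **The Frobenius identity in the formal group of `Ẽ`, case `a < 0`, every prime `p`**: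
`F̃(X^{p²}, [p]˜(X)) = ĩ([|a|]˜(Xᵖ))`. [cite: SilvermanAEC2009, Thm. V.2.3.1(b)] -/
theorem frobenius_formal_identity_of_neg'
    (ha : Literature.NumberTheory.EllipticCurves.HasseManin.tr (V.map PadicInt.toZMod) < 0) :
    MvPowerSeries.subst ![(PowerSeries.X : (ZMod p)⟦X⟧) ^ p ^ 2,
        ((V.map PadicInt.toZMod).formalMul p).subst (PowerSeries.X : (ZMod p)⟦X⟧)] (V.map PadicInt.toZMod).formalGroupLaw =
      (V.map PadicInt.toZMod).formalNeg.subst (((V.map PadicInt.toZMod).formalMul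
        (Literature.NumberTheory.EllipticCurves.HasseManin.tr (V.map PadicInt.toZMod)).natAbs).subst
        ((PowerSeries.X : (ZMod p)⟦X⟧) ^ p)) := by
  set a := Literature.NumberTheory.EllipticCurves.HasseManin.tr (V.map PadicInt.toZMod) with hadef
  have hp0 : p ≠ 0 := hp.out.ne_zero
  have hX : constantCoeff (PowerSeries.X : (ZMod p)⟦X⟧) = 0 := PowerSeries.constantCoeff_X
  have hXp : constantCoeff ((PowerSeries.X : (ZMod p)⟦X⟧) ^ p) = 0 := constantCoeff_pow_prime hX hp0
  have hXp2 : constantCoeff ((PowerSeries.X : (ZMod p)⟦X⟧) ^ p ^ 2) = 0 :=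
    constantCoeff_pow_prime hX (pow_ne_zero 2 hp0)
  have hpX : constantCoeff (((V.map PadicInt.toZMod).formalMul p).subst (PowerSeries.X : (ZMod p)⟦X⟧)) = 0 :=
    (Literature.RingTheory.FormalGroups.constantCoeff_subst_of_constantCoeff_eq_zero hX _).trans
      ((V.map PadicInt.toZMod).constantCoeff_formalMul p)
  have hm : constantCoeff (((V.map PadicInt.toZMod).formalMul a.natAbs).subst
      ((PowerSeries.X : (ZMod p)⟦X⟧) ^ p)) = 0 :=
    (Literature.RingTheory.FormalGroups.constantCoeff_subst_of_constantCoeff_eq_zero hXp _).trans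
      ((V.map PadicInt.toZMod).constantCoeff_formalMul _)
  have hrel := (V.map PadicInt.toZMod).frob_relation_laurentPt
  rw [← hadef] at hrel
  refine laurentPt_injective (E := V.map PadicInt.toZMod)
    (constantCoeff_formalGroupLaw_subst_pair V PadicInt.toZMod hXp2 hpX) (constantCoeff_formalNeg_subst hm) ?_
  rw [laurentPt_formalGroupLaw' V PadicInt.toZMod hXp2 hpX, laurentPt_formalMul' V PadicInt.toZMod p hX,
    ← neg_laurentPt hm, laurentPt_formalMul' V PadicInt.toZMod _ hXp, ← natCast_zsmul, ← natCast_zsmul,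
    ← neg_zsmul]
  have hna : -((a.natAbs : ℕ) : ℤ) = a := by omega
  rw [hna]
  rw [sub_add_eq_add_sub, sub_eq_zero] at hrel
  exact hrel

/-- **The Frobenius identity mod `p`, every prime `p`**: `G_V ≡ [a](Xᵖ)` resp. `≡ i([|a|](Xᵖ))`
in `𝔽_p⟦X⟧`, `a = p + 1 − #Ṽ(𝔽_p)` — as `map_toZMod_frobLHS_sub_eq_zero`.
[cite: SilvermanAEC2009, Thm. V.2.3.1(b)] -/
theorem map_toZMod_frobLHS_sub_eq_zero' :
    (frobLHS p V - (if 0 ≤ Literature.NumberTheory.EllipticCurves.HasseManin.tr (V.map PadicInt.toZMod) then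
        frobRHSPos p V (Literature.NumberTheory.EllipticCurves.HasseManin.tr (V.map PadicInt.toZMod)).toNat
      else frobRHSNeg p V (Literature.NumberTheory.EllipticCurves.HasseManin.tr (V.map PadicInt.toZMod)).natAbs)).map
      PadicInt.toZMod = 0 := by
  have hp0 : p ≠ 0 := hp.out.ne_zero
  rw [map_sub, map_frobLHS p V _ hp0, sub_eq_zero]
  split_ifs with ha
  · rw [map_frobRHSPos p V _ hp0]
    exact V.frobenius_formal_identity_of_nonneg' ha
  · rw [map_frobRHSNeg p V _ hp0]
    exact V.frobenius_formal_identity_of_neg' (lt_of_not_ge ha)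

end FormalIdentity

/-! ## Honda's congruences `hondaShift p a log_W ∈ ℤ_p⟦X⟧`, every `p` -/

section Main

variable {p : ℕ} [hp : Fact p.Prime] (V : WeierstrassCurve ℤ_[p]) [hE : (V.map PadicInt.Coe.ringHom).IsElliptic]
  [hEt : (V.map PadicInt.toZMod).IsElliptic]

/-- **Honda's congruences for `log_W`, every prime `p` (`p = 2` included).** For a Weierstrass
equation `V` over `ℤ_p` with elliptic generic and special fibres and `a = p + 1 − #Ṽ(𝔽_p)`:
`hondaShift p a log_W = log_W − (a/p) log_W(Xᵖ) + (1/p) log_W(X^{p²})` has `p`-integral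
coefficients, i.e. `log_W` is of Honda type `p − aT + T²` — as `norm_coeff_hondaShift_formalLog_le_one`,
with the Frobenius identity `map_toZMod_frobLHS_sub_eq_zero'` valid at every `p`.
[Honda, J. Math. Soc. Japan 22 (1970), Thm. 9 (proof); Hazewinkel, Formal Groups, §33.1]
[cite: Honda1970, Thm. 9 (pp. 240–241)] -/
theorem norm_coeff_hondaShift_formalLog_le_one' (n : ℕ) :
    ‖coeff n (Literature.RingTheory.FormalGroups.hondaShift p
        ((Literature.NumberTheory.EllipticCurves.HasseManin.tr (V.map PadicInt.toZMod) : ℤ) : ℚ_[p])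
        (V.map PadicInt.Coe.ringHom).formalLog)‖ ≤ 1 := by
  haveI := V.isIntegral_map_coe
  set W := V.map PadicInt.Coe.ringHom with hWdef
  set a := Literature.NumberTheory.EllipticCurves.HasseManin.tr (V.map PadicInt.toZMod) with hadef
  have hp0 : p ≠ 0 := hp.out.ne_zero
  set Rz : ℤ_[p]⟦X⟧ := if 0 ≤ a then frobRHSPos p V a.toNat else frobRHSNeg p V a.natAbs with hRz
  have hmod : (frobLHS p V - Rz).map PadicInt.toZMod = 0 := V.map_toZMod_frobLHS_sub_eq_zero'
  -- the two `ℚ_p`-series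
  set u : ℚ_[p]⟦X⟧ := (frobLHS p V).map PadicInt.Coe.ringHom with hu
  set v : ℚ_[p]⟦X⟧ := Rz.map PadicInt.Coe.ringHom with hv
  have hu' : u = frobLHS p W := by rw [hu, map_frobLHS p V _ hp0]
  have huv : ∀ n, ‖coeff n (u - v)‖ ≤ (p : ℝ)⁻¹ := fun n => by
    rw [hu, hv, ← map_sub]
    exact norm_coeff_map_le_inv_of_map_toZMod hmod n
  have hint : ∀ (f : ℤ_[p]⟦X⟧) (n : ℕ), ‖coeff n (f.map (PadicInt.Coe.ringHom (p := p)))‖ ≤ 1 := fun f n => by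
    rw [coeff_map]; exact PadicInt.norm_le_one _
  have hu0 : constantCoeff u = 0 := by
    rw [hu, ← coeff_zero_eq_constantCoeff, coeff_map, coeff_zero_eq_constantCoeff,
      V.constantCoeff_frobLHS p hp0, map_zero]
  have hv0 : constantCoeff v = 0 := by
    rw [hv, ← coeff_zero_eq_constantCoeff, coeff_map, coeff_zero_eq_constantCoeff, hRz]
    split_ifs
    · rw [V.constantCoeff_frobRHSPos p hp0, map_zero]
    · rw [V.constantCoeff_frobRHSNeg p hp0, map_zero]
  have key := Literature.RingTheory.FormalGroups.norm_coeff_subst_sub_subst_le_of_natCast_mul_coeff_le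
    (W.norm_natCast_mul_coeff_formalLog_le) hu0 (hint _) hv0 (hint _) huv n
  -- compute the logarithms
  have hlog : W.formalLog.subst u - W.formalLog.subst v =
      PowerSeries.expand (p ^ 2) (Literature.RingTheory.FormalGroups.prime_sq_ne_zero p) W.formalLog +
        p • W.formalLog - (a : ℚ_[p]) • PowerSeries.expand p (Literature.RingTheory.FormalGroups.prime_ne_zero p)
          W.formalLog := by
    rw [hu', W.formalLog_subst_frobLHS, hv, hRz]
    split_ifs with ha
    · have hta : ((a.toNat : ℕ) : ℚ_[p]) = (a : ℚ_[p]) := by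
        rw [← Int.cast_natCast, Int.toNat_of_nonneg ha]
      rw [map_frobRHSPos p V _ hp0, ← hWdef, W.formalLog_subst_frobRHSPos,
        ← Nat.cast_smul_eq_nsmul ℚ_[p] a.toNat, hta]
    · have hna : ((a.natAbs : ℕ) : ℤ) = -a := by omega
      have hna' : ((a.natAbs : ℕ) : ℚ_[p]) = -(a : ℚ_[p]) := by
        rw [← Int.cast_natCast, hna, Int.cast_neg]
      rw [map_frobRHSNeg p V _ hp0, ← hWdef, W.formalLog_subst_frobRHSNeg,
        ← Nat.cast_smul_eq_nsmul ℚ_[p] a.natAbs, hna', neg_smul, sub_neg_eq_add, ← sub_eq_add_neg]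
  rw [hondaShift_eq_C_mul, ← hlog, coeff_C_mul, norm_mul, norm_inv]
  have hnp : ‖(p : ℚ_[p])‖ = (p : ℝ)⁻¹ := Padic.norm_p
  rw [hnp, inv_inv]
  have hp' : (0 : ℝ) < p := by exact_mod_cast hp.out.pos
  calc (p : ℝ) * ‖coeff n (W.formalLog.subst u - W.formalLog.subst v)‖ ≤ p * (p : ℝ)⁻¹ :=
        mul_le_mul_of_nonneg_left key hp'.le
    _ = 1 := mul_inv_cancel₀ hp'.ne'

end Main

/-! ## Finite height `[p]˜ ≠ 0`, every `p` -/

section FiniteHeight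

variable {p : ℕ} [hp : Fact p.Prime] (V : WeierstrassCurve ℤ_[p])
  [hE : (V.map PadicInt.Coe.ringHom).IsElliptic] [hEt : (V.map PadicInt.toZMod).IsElliptic]

/-- **The reduced formal group has finite height, every prime `p`: `[p]˜ ≠ 0` in `𝔽_p⟦X⟧`**
(elliptic fibres) — as `formalMul_prime_map_toZMod_ne_zero`, from the Frobenius identity
`frobenius_formal_identity_of_nonneg' / _of_neg'`. [cite: SilvermanAEC2009, Thm. V.2.3.1(b) and IV.7] -/
theorem formalMul_prime_map_toZMod_ne_zero' : (V.map PadicInt.toZMod).formalMul p ≠ 0 := by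
  intro h0
  have hp0 : p ≠ 0 := hp.out.ne_zero
  have hp1 : 1 < p := hp.out.one_lt
  have hpp : ¬ p ^ 2 = p := by
    intro h; rw [sq] at h; exact absurd (mul_right_cancel₀ hp0 (h.trans (one_mul p).symm)) hp.out.ne_one
  set E := V.map PadicInt.toZMod with hEdef
  have hXp : HasSubst ((X : (ZMod p)⟦X⟧) ^ p) := HasSubst.X_pow hp0
  have hXne : (X : (ZMod p)⟦X⟧) ^ p ^ 2 ≠ 0 := pow_ne_zero _ X_ne_zero
  -- the left-hand side of the Frobenius identity collapses to `X^{p²}`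
  have hLHS : MvPowerSeries.subst ![(X : (ZMod p)⟦X⟧) ^ p ^ 2, (E.formalMul p).subst (X : (ZMod p)⟦X⟧)]
      E.formalGroupLaw = (X : (ZMod p)⟦X⟧) ^ p ^ 2 := by
    rw [h0, zero_subst_eq_zero HasSubst.X',
      E.formalGroupLaw_subst_pair_zero_right (constantCoeff_X_pow' (pow_ne_zero 2 hp0))]
  -- `[m]˜ = 0` as soon as `p ∣ m`
  have hmul : ∀ m : ℕ, p ∣ m → E.formalMul m = 0 := by
    rintro m ⟨k, rfl⟩
    rw [← E.formalMul_mul_subst' p k, h0, zero_subst_eq_zero (E.hasSubst_formalMul k)]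
  -- coefficient of `Xᵖ` of a series of the form `h(Xᵖ)`
  have hcoeff : ∀ h : (ZMod p)⟦X⟧, coeff p (h.subst ((X : (ZMod p)⟦X⟧) ^ p)) = coeff 1 h := fun h ↦ by
    rw [coeff_subst_X_pow hp0, if_pos dvd_rfl, Nat.div_self hp.out.pos]; rfl
  have hcoeffL : coeff p ((X : (ZMod p)⟦X⟧) ^ p ^ 2) = 0 := by rw [coeff_X_pow, if_neg (Ne.symm hpp)]
  rcases le_or_gt 0 (Literature.NumberTheory.EllipticCurves.HasseManin.tr E) with ha | ha
  · have hid := V.frobenius_formal_identity_of_nonneg' ha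
    rw [← hEdef] at hid
    rw [hLHS] at hid
    have hc := congrArg (coeff p) hid
    rw [hcoeffL, hcoeff, coeff_one_formalMul'] at hc
    have hdvd : p ∣ (Literature.NumberTheory.EllipticCurves.HasseManin.tr E).toNat :=
      (ZMod.natCast_eq_zero_iff _ _).mp hc.symm
    rw [hmul _ hdvd, zero_subst_eq_zero hXp] at hid
    exact hXne hid
  · have hid := V.frobenius_formal_identity_of_neg' ha
    rw [← hEdef] at hid
    rw [hLHS, ← subst_comp_subst_apply (E.hasSubst_formalMul _) hXp] at hid
    have hc := congrArg (coeff p) hid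
    rw [hcoeffL, hcoeff, coeff_one_subst_eq_mul _ (E.constantCoeff_formalMul _), coeff_one_formalNeg,
      coeff_one_formalMul', neg_one_mul, eq_comm, neg_eq_zero] at hc
    have hdvd : p ∣ (Literature.NumberTheory.EllipticCurves.HasseManin.tr E).natAbs :=
      (ZMod.natCast_eq_zero_iff _ _).mp hc
    rw [hmul _ hdvd, PowerSeries.subst_zero_of_constantCoeff_zero E.constantCoeff_formalNeg,
      zero_subst_eq_zero hXp] at hid
    exact hXne hid

/-- **`[n]˜ ≠ 0` for every `n ≥ 1`, every prime `p`** (elliptic fibres) — as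
`formalMul_map_toZMod_ne_zero`. [cite: SilvermanAEC2009, IV.7] -/
theorem formalMul_map_toZMod_ne_zero' {n : ℕ} (hn : 0 < n) :
    (V.map PadicInt.toZMod).formalMul n ≠ 0 := by
  set E := V.map PadicInt.toZMod with hEdef
  have hp0 : p ≠ 0 := hp.out.ne_zero
  have hP := V.formalMul_prime_map_toZMod_ne_zero'
  rw [← hEdef] at hP
  have hpow : ∀ k : ℕ, E.formalMul (p ^ k) ≠ 0 := by
    intro k
    induction k with
    | zero => rw [pow_zero]; intro h; have := congrArg (coeff 1) h
              rw [coeff_one_formalMul', Nat.cast_one, map_zero] at this; exact one_ne_zero this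
    | succ k ih =>
      rw [pow_succ', ← E.formalMul_mul_subst' p (p ^ k)]
      exact subst_ne_zero_of_ne_zero hP (E.constantCoeff_formalMul _) ih
  obtain ⟨k, m, hm, rfl⟩ := Nat.exists_eq_pow_mul_and_not_dvd hn.ne' p hp.out.ne_one
  rw [← E.formalMul_mul_subst' (p ^ k) m]
  refine subst_ne_zero_of_ne_zero (hpow k) (E.constantCoeff_formalMul m) fun h ↦ ?_
  have := congrArg (coeff 1) h
  rw [coeff_one_formalMul', map_zero] at this
  exact hm ((ZMod.natCast_eq_zero_iff m p).mp this)

/-- **Some coefficient of `[n](θ(X))` in positive degree is a `p`-adic unit**, every prime `p`,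
for `n ≥ 1` and a change of parameter `θ = uX + ⋯ ∈ ℤ_p⟦X⟧`, `u ∈ ℤ_pˣ` (elliptic fibres) — the
finite-height hypothesis of `Literature.RingTheory.PowerSeries.padicInt_exists_map_eq_of_subst_eq_map`;
as `exists_isUnit_coeff_formalMul_subst`. [cite: SilvermanAEC2009, IV.7] -/
theorem exists_isUnit_coeff_formalMul_subst' {n : ℕ} (hn : 0 < n) {θ : ℤ_[p]⟦X⟧}
    (hθ0 : constantCoeff θ = 0) (hθ1 : IsUnit (coeff 1 θ)) :
    ∃ d : ℕ, 0 < d ∧ IsUnit (coeff d ((V.formalMul n).subst θ)) := by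
  have hsθ : HasSubst θ := HasSubst.of_constantCoeff_zero' hθ0
  have hms : PowerSeries.map PadicInt.toZMod ((V.formalMul n).subst θ) =
      ((V.map PadicInt.toZMod).formalMul n).subst (PowerSeries.map PadicInt.toZMod θ) := by
    rw [powerSeries_map_subst _ hsθ, map_formalMul]
  have hne : PowerSeries.map PadicInt.toZMod ((V.formalMul n).subst θ) ≠ 0 := by
    rw [hms]
    refine subst_ne_zero_of_isUnit_coeff_one (V.formalMul_map_toZMod_ne_zero' hn) ?_ ?_
    · rw [← coeff_zero_eq_constantCoeff_apply, coeff_map, coeff_zero_eq_constantCoeff_apply, hθ0,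
        map_zero]
    · rw [coeff_map]; exact hθ1.map _
  obtain ⟨d, hd⟩ := exists_coeff_ne_zero_iff_ne_zero.mpr hne
  rw [coeff_map] at hd
  refine ⟨d, Nat.pos_of_ne_zero ?_, isUnit_of_toZMod_ne_zero hd⟩
  rintro rfl
  apply hd
  rw [coeff_zero_eq_constantCoeff_apply, constantCoeff_subst_eq_constantCoeff hθ0,
    V.constantCoeff_formalMul n, map_zero]

/-- The same for `[n]` itself (`θ = X`), every prime `p`. [cite: SilvermanAEC2009, IV.7] -/
theorem exists_isUnit_coeff_formalMul' {n : ℕ} (hn : 0 < n) :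
    ∃ d : ℕ, 0 < d ∧ IsUnit (coeff d (V.formalMul n)) := by
  have h := V.exists_isUnit_coeff_formalMul_subst' hn (θ := X) constantCoeff_X
    (by rw [coeff_one_X]; exact isUnit_one)
  rwa [powerSeries_subst_X_self] at h

end FiniteHeight

end WeierstrassCurve
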